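import Summits.Ventures.PercRepro.C041PendantSix

/-!
# ROW C-041 — THE CONE IS CLOSED UNDER PENDANT ATTACHMENT (p6, gen 29; mine-3's C-041.md §20 (b), the
six-vector identity `Π(Z₁ ∪_u Z₂) = x·ℓ(ψΠ₂) + z·Π₂ + w·n′·𝟙`)

From the six counts over the four classes (`C041PendantSix`): `sixVec_pendant_four` is the identity
`Π(Z₁ ∪_u Z₂) = x·(F, F+T₁, F+T₂, F, F+T₁, F+T₂) + y·(n′, n′, n′, I, I, I) + z·Π(Z₂) + w·n′·𝟙`, and with `x = y`
(`xCount_eq_yCount`) and `n′ = F + T₁ + T₂` the first two terms are `x·ℓ(F, T₁, T₂, I)` (`sixVec_pendant`).  Hence,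
by mine-3's decomposition lemma (`InCone.mul_ell`, `C041TreeClosure`: `ℓ(c) ∈ cone` for `c ∈ 𝒦`) and `K4v_of_InCone`,
**cone membership of `Π(Z₂)` gives cone membership of `Π(Z₁ ∪_u Z₂)`** (`inCone_sixVec_pendant`).  Together with
`C041AnchorGlueSix` (the cone is closed under gluing at the anchor) both operations of the class 𝒵 of §20 (b)(3)
are kernel theorems in the six-vector form.
-/

namespace PercRepro

namespace ZoneZ

namespace Pendant

open ZoneData TreeClosure Finset

universe u₁ u₂ u₃ u₄ u₅ u₆ u₇ u₈

variable {V₁ : Type u₁} {E₁ : Type u₂} {U₁ : Type u₃} {U₂ : Type u₄} {V₂ : Type u₅} {E₂ : Type u₆}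
  {T₁ : Type u₇} {T₂ : Type u₈}
variable (Z₁ : ZoneData V₁ E₁ U₁ U₂) (u : V₁) (Z₂ : ZoneData V₂ E₂ T₁ T₂) (a₂ : V₂) (a : V₁)
variable [Fintype E₁] [DecidableEq E₁] [Fintype E₂] [DecidableEq E₂] [Fintype T₁] [DecidableEq T₁]
  [Fintype T₂] [DecidableEq T₂]

/-- The six-vector of a zone's all-red / no-blue-`2` / no-blue-`1` counts repeated: the contribution of the
merged-unreached class. -/
noncomputable def vecB : Vec6 :=
  ![(#(Z₂.Fset a₂) : ℝ), #(Z₂.FAset a₂), #(Z₂.FBset a₂), #(Z₂.Fset a₂), #(Z₂.FAset a₂), #(Z₂.FBset a₂)]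

/-- The contribution of the separated-reached class: `(n′, n′, n′, I, I, I)`. -/
noncomputable def vecR : Vec6 :=
  ![(#(Z₂.Aset (∅ : Set V₂)) : ℝ), #(Z₂.Aset (∅ : Set V₂)), #(Z₂.Aset (∅ : Set V₂)), #(Z₂.Iset a₂),
    #(Z₂.Iset a₂), #(Z₂.Iset a₂)]

/-- **The six-vector identity over the four classes**:
`Π(Z₁ ∪_u Z₂) = x·B + y·R + z·Π(Z₂) + w·n′·𝟙`. -/
theorem sixVec_pendant_four :
    (pendant Z₁ u Z₂ a₂).sixVec (Sum.inl a) =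
      (xCount Z₁ u a : ℝ) • vecB Z₂ a₂ + (yCount Z₁ u a : ℝ) • vecR Z₂ a₂ +
        (zCount Z₁ u a : ℝ) • Z₂.sixVec a₂ + ((wCount Z₁ u a * #(Z₂.Aset (∅ : Set V₂)) : ℕ) : ℝ) • (1 : Vec6) := by
  funext i
  fin_cases i
  · show (pendant Z₁ u Z₂ a₂).sixVec (Sum.inl a) 0 = _
    rw [sixVec_zero, card_Fset_four]
    simp [vecB, vecR, sixVec]
  · show (pendant Z₁ u Z₂ a₂).sixVec (Sum.inl a) 1 = _
    rw [sixVec_one, card_FAset_four]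
    simp [vecB, vecR, sixVec]
  · show (pendant Z₁ u Z₂ a₂).sixVec (Sum.inl a) 2 = _
    rw [sixVec_two, card_FBset_four]
    simp [vecB, vecR, sixVec]
  · show (pendant Z₁ u Z₂ a₂).sixVec (Sum.inl a) 3 = _
    rw [sixVec_three, card_IFset_four]
    simp [vecB, vecR, sixVec]
  · show (pendant Z₁ u Z₂ a₂).sixVec (Sum.inl a) 4 = _
    rw [sixVec_four, card_IAset_four]
    simp [vecB, vecR, sixVec]
  · show (pendant Z₁ u Z₂ a₂).sixVec (Sum.inl a) 5 = _
    rw [sixVec_five, card_IBset_four]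
    simp [vecB, vecR, sixVec]

/-- `B + R = ℓ(F, T₁, T₂, I)`: the two mirror classes add up to the ℓ-vector of `Z₂`'s root 4-vector. -/
theorem vecB_add_vecR :
    vecB Z₂ a₂ + vecR Z₂ a₂ = ell (#(Z₂.Fset a₂)) (#(Z₂.T1set a₂)) (#(Z₂.T2set a₂)) (#(Z₂.Iset a₂)) := by
  have hN := Z₂.card_Aset_eq_count a₂
  have hA := Z₂.card_FAset a₂
  have hB := Z₂.card_FBset a₂
  funext i
  fin_cases i <;> simp [vecB, vecR, ell, hN, hA, hB] <;> ring

/-- **THEOREM (PENDANT ZONE) in six-vector form**: `Π(Z₁ ∪_u Z₂) = x·ℓ(ψΠ₂) + z·Π₂ + w·n′·𝟙`. -/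
theorem sixVec_pendant :
    (pendant Z₁ u Z₂ a₂).sixVec (Sum.inl a) =
      (xCount Z₁ u a : ℝ) • ell (#(Z₂.Fset a₂)) (#(Z₂.T1set a₂)) (#(Z₂.T2set a₂)) (#(Z₂.Iset a₂)) +
        (zCount Z₁ u a : ℝ) • Z₂.sixVec a₂ + ((wCount Z₁ u a * #(Z₂.Aset (∅ : Set V₂)) : ℕ) : ℝ) • (1 : Vec6) := by
  rw [sixVec_pendant_four, ← xCount_eq_yCount, ← smul_add, vecB_add_vecR]

/-- **The cone is closed under pendant attachment.** -/
theorem inCone_sixVec_pendant (h : InCone (Z₂.sixVec a₂)) : InCone ((pendant Z₁ u Z₂ a₂).sixVec (Sum.inl a)) := by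
  rw [sixVec_pendant]
  have hK := Z₂.K4_of_inCone_sixVec a₂ h
  have hℓ : InCone (ell (#(Z₂.Fset a₂)) (#(Z₂.T1set a₂)) (#(Z₂.T2set a₂)) (#(Z₂.Iset a₂))) := by
    have := InCone_one.mul_ell hK
    rwa [one_mul] at this
  exact InCone.add (InCone.add (InCone.smul _ (Nat.cast_nonneg _) hℓ) (InCone.smul _ (Nat.cast_nonneg _) h))
    (InCone.smul _ (Nat.cast_nonneg _) InCone_one)

/-- The ZONE O-CUBE on a cone member hung at any vertex of any unmarked multigraph (six-vector form). -/
theorem zoneOCubeConj_pendant_of_inCone (h : InCone (Z₂.sixVec a₂)) :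
    (pendant Z₁ u Z₂ a₂).ZoneOCubeConj {Sum.inl a} (∅ : Set (V₁ ⊕ V₂)) :=
  (pendant Z₁ u Z₂ a₂).zoneOCubeConj_of_inCone_sixVec (Sum.inl a) (inCone_sixVec_pendant Z₁ u Z₂ a₂ a h)

end Pendant

end ZoneZ

end PercRepro
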